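import Summits.QuantumFields.YangMills.Theorems.BalabanUVNodesK0AxCtabOrbitIffCrit
import Summits.QuantumFields.YangMills.Theorems.BalabanUVNodesN07P0FixedPointIsRecordMinimiserAtChart

/-!
# NODE O · K0ᴬ — THE P0 JUNCTION SOCKET «ROOTING IS A GRADIENT AT FIRST ORDER»: the receipts (C-wcg) ∕ (C-orb) ∕ (C-crit) ∕ (C-cons) of the ROOTED response
# `recordD` TRANSFER VERBATIM to the response of ANY chart `U(B)` with `recordBgField = rootGauge ∘ U` near `B = 0`; instantiated at node00-def-Y's `BgScheme.chartCfg`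

LANDING NOTE (porter ▶ PTC-1 g4, 2026-08-31; AUTHORSHIP = ◇ lens-1 g11 «cauchy-analytic», HOME sketch `nodeO-cover/LENS-1g11-JunctionRootGrad-v1.lean` sha16 ef4e791fbbd67beb · 544 l. · 6 def + 23
thm · 0 sorry): the HOME file exceeds the gate's 400-line cap, so it is landed as THREE files by a MECHANICAL split (◇ lens-1 g11's OPTION (b) three-file variant, nodeO STATUS 11:07:50Z; generator
`work/gen/build_split_rootgrad3.py` of this seat; docstrings, statements and proofs BYTE-IDENTICAL to the HOME sketch; imports as the monolith): FILE 1
`…Theorems/BalabanUVNodesK0AxRootGradCalc.lean` = header + §1 (ns `K0AxRootGrad`: generic calculus of the rooted gauge at the unit configuration), FILE 2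
`…Theorems/BalabanUVNodesK0AxJunctionRootGrad.lean` = header + `import …K0AxRootGradCalc` + §2 (ns `K0AxCtabUniq`: `chartRespD`, the displayed chart-level letters, rooted ⟺ chart transfer of the
receipts), FILE 3 `…Theorems/BalabanUVNodesK0AxJunctionRootGradScheme.lean` = header + `import …K0AxJunctionRootGrad` + §2's namespace∕`open`∕`variable` preamble + §3 (`section Scheme`: the def-Y
`BgScheme` ∕ KNIT instances). THIS IS FILE 1 OF 3 (the others: `…K0AxJunctionRootGrad` ∕ `…K0AxJunctionRootGradScheme`).  Landed on ◇ lens-1 g11's CANDIDATE 1 (nodeO STATUS 11:05:04Z), after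
✓p820208 `…K0AxCtabOrbitIffCrit` (B-5) and node00-def-Y's ✓`…N07P0FixedPointIsRecordMinimiserAtChart`; ◆ CRIT-1 g37's cut + J1′∕J4∕J5′ stamp: SAME-WALL verdict SURVIVES (PRICED); CUT = GO
THREE-FILE (b) AS STAGED (INTENT-53∕54∕55); J1′ ∕ J4 ∕ J5′ ∕ (Q-ord) ∕ (Q-bridge) PASS; axioms standard on ◆'s monolith run; price displayed: (p1) `ChartResponseWeaklyCriticalAt` at def-Y's chart
— print's statement ONLY for a scheme whose `bg` is the CONSTANT flat `U₀` and whose chart is the (21)-Landau-gauge representative ([15] §G p.305, (174)–(178)); def-Y's `bgSchemeOfRecord`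
qualifies, for any other representative of the orbit `chartRespD` shifts by a gradient and (p1) runs into the STRUCK (C-tab-opt) wall — plus (p2) factorisation tokens, (p3) `chartCfg 1 = 1` ∕ C²
chart entries, (p4) range guard, and the two flat dictionaries (J-crit)∕(J-cons), all OPEN (nodeO STATUS 2026-08-31T11:13:06Z); helper `--supports stmt-QuantumFields-27238 --as helper` (NO
`--workitem`).  HONEST (porter): calculus of finite matrix products + bookkeeping; CONDITIONAL theorems over DISPLAYED letters (`RootFactorAt`, `ChartRegAt`, `ChartResponseWeaklyCriticalAt`,
def-Y∕KNIT tokens — all OPEN, asserted nowhere); (C-tab-opt) stays STRUCK; nothing of Bałaban asserted, ported, discharged or refuted; K0ᴬ stmt-QuantumFields-27238 ∕ K0⁷ 20541 OPEN — NOTHING of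
them proved; NODE O 0∕1; COUNT 8∕28 · K 1∕4 UNMOVED; finite 𝕋⁴ at fixed ε — NOT continuum ∕ OS ∕ Clay; the Yang–Mills mass gap is NOT proved by any of this.

◇ `ymgap-nodeO-lens-1` g11 (planner; typed for the porter ▶ PTC-1; proposed basename `…/Theorems/BalabanUVNodesK0AxJunctionRootGrad.lean`,
`--supports stmt-QuantumFields-27238 --as helper`).  Items: K0ᴬ stmt-QuantumFields-27238 OPEN; K0⁷ stmt-QuantumFields-20541 OPEN.  [15] = [Balaban1985Variational],
[I] = [Balaban1987RG1], [B6] = [Balaban1984PropagatorsII].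

WHY.  After B-5 (✓`…K0AxCtabOrbitIffCrit`) the one displayed NON-P0-token leaf of the (R-a) road is (C-orb) ⟺ (C-wcg) ⟺ (C-crit) ∧ (C-cons), all stated on the ROOTED
table `recordD := D|₀ (entries of UkSel F 2 K (k+1) εbg (unitField B))`.  Their supplier is P0 = node00-def-Y's `BgScheme` ([15] Prop. 6 ∕ Thm 1 as a named map:
✓`Node00.BackgroundMapOfRecord`, ✓`…BgSchemeOfRecordC`, (s2) `…BgSchemeOfRecordEL`), which speaks of the CHART IMAGE `chartCfg S V` of the (116)-fixed point, while the
selector adds the ROOTED GAUGE: ✓`UkSel_eq_rootGauge_chartCfg_of_orbitRel` («`UkSel V = rootGauge (chartCfg S V)`» under the (11′)-tokens).  The seam (◆ Q-27: «the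
real-side identification `recordBgField = chart ∘ …` is in NO file») is closed here by ONE calculus fact: at the unit configuration the rooted gauge `U ↦ U^{g_U}`
(`T4RootedResidualGauge.rootGauge`, `g_U(x)` = holonomy along the coordinate path from the block root) has derivative `Y ↦ Y + (Ψ(b₋) − Ψ(b₊))`, `Ψ := D g(1)`, i.e.
ROOTING CONTRIBUTES A PURE (unrestricted) GRADIENT — and every receipt of the road is a statement MODULO unrestricted gradients.  So the receipts for `recordD` are
EQUIVALENT to the same receipts for the chart response `chartRespD U := D|₀ (entries of U(B))`, for ANY factorisation `recordBgField =ᶠ rootGauge (k+1) ∘ U` with `U(0) = 1`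
and differentiable entries; no property of the selector, no Landau representative, no `N(Q′)`-clause is used, and NO identity `recordD = (transverse table)` is stated (J5′).

WHAT IS PROVED (kernel, sorry-free, standard axioms).
§1 (generic, any real normed parameter space `E`, any `Params`): `differentiableAt_coe_lineHol ∕ _pathHol ∕ _rootTransporter` and the `Cⁿ` twins `contDiffAt_coe_lineHol ∕ _pathHol ∕
   _rootGauge` (finite products and adjoints); ★ `hasFDerivAt_coe_rootGauge`:
   if `U e₀ = 1` and the bond matrices of `U e` are differentiable at `e₀`, then `e ↦ (rootGauge k (U e))(b)` has derivative `DU(b) + (Ψ b.src − Ψ b.tgt)` at `e₀` with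
   `Ψ x := D(e ↦ g_{U e}(x))(e₀)` anti-Hermitian-valued (`star (Ψ x v) = −Ψ x v`, from `g ∈ SU(2)`).
§2 (K0 letters, namespace `K0AxCtabUniq`): `chartRespD` (the chart twin of ✓`recordD`); displayed letters `RootFactorAt` (factorisation), `ChartRegAt`, `ChartResponseCriticalModGaugeAt`,
   `ChartResponseWeaklyCriticalAt`; ★★ `recordD_eq_chartRespD_add_grad` (under the factorisation token: `recordD a l b = chartRespD U a l b + (ψ(b₋) − ψ(b₊))`); ★★
   `contDiffAt_recordBgField_entries_of_chart` (TokP9reg♭ᵣ — `Cⁿ` entries of `recordBgField` at `0` — FROM `Cⁿ` chart entries, `n = 2` the displayed letter of ✓`twoVolExp_orbit_images`); ★★ `rootedResponseOrbitAt_iff_chart`, ★★ `criticalModGauge_iff_chart` ((C-orb), (C-wcg) are INVARIANT under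
   the passage rooted ↔ chart); ★★★ `criticalModGauge_of_chart_weaklyCritical`: if the chart response ITSELF is weakly critical (the `φ₀ = 0` shape — legitimate for a chart in
   the (21)-Landau gauge, unlike for the rooted table where it is the STRUCK (C-tab-opt)), then (C-wcg), hence (C-orb) (✓`rootedResponseOrbitAt_of_criticalModGauge`) and
   (C-crit) ∧ (C-cons) (✓`criticalModGauge_iff_invCritical_and_constraintModGauge`).
§3 (the def-Y instance): `ChartMinimiserResTok` (DISPLAYED: the Prop-7 gauge transform of `Prop7Tok` may be taken RESIDUAL of level `k+1` — p. 299 «U_k = (U₁U₀)^u» with `u`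
   the axial∕rooted normaliser); ★★ `eventually_recordBgField_eq_rootGauge_chartCfg` (the factorisation token FROM `UniqTok` + `ChartMinimiserResTok` + «charted fields near
   `B = 0` lie in the (7)-domain», by ✓`UkSel_eq_rootGauge_chartCfg_of_orbitRel`); ★★★ `rootedReceipts_of_bgScheme`: the four receipts (C-wcg) ∕ (C-orb) ∕ (C-crit) ∕ (C-cons)
   for ALL `a l` FROM the displayed scheme-level letters {`UniqTok`, `ChartMinimiserResTok`, domain near flat, `chartCfg S 1 = 1`, differentiable chart entries at `B = 0`,
   chart response weakly critical}, and ★★ `tokP9reg_of_bgScheme` (TokP9reg♭ᵣ from the same tokens + `C²` chart entries) — so EVERY non-D1 leaf of ✓`twoVolExp_orbit_images` is now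
   addressed at scheme level; ★★ `rootFactorAt_of_tokens_chart` ∕ ★★★ `rootedReceipts_of_tokens_chart`: the same with the factorisation supplied by the N07∕P0 KNIT
   (✓`N07P0FixedPointIsRecordMinimiser.ukSel_eq_rootGauge_chartCfg_of_tokens_chart`, dag-n07-w3: tokens (rng)(cov)(c→s)(min) at `S.chart V` + `S.RegimeTok`) instead of
   `UniqTok` + `ChartMinimiserResTok`; ★★★ `rootedReceipts_of_chart`: the four receipts from the three chart-level letters for ANY chart.  The weak-criticality letter is
   exactly what (s2)∕(s3) of node00-def-Y (EL (111) + constraint (109) + Hessian at the flat background) are to deliver,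
   now addressed to the CHART, where print states it ([15] (176)–(178), [B6] (2.35)), and no longer to the selector.

HONEST.  Calculus of finite matrix products + bookkeeping; CONDITIONAL theorems over DISPLAYED letters; nothing of Bałaban ([15] Thm 1, Prop. 6–9, (176)–(178); [B6] (2.35);
[I] (4.35)) is asserted, ported or discharged; (C-tab-opt) stays STRUCK; P0's tokens, D1 ⟨27930⟩, TokP9reg♭, (Tok-cmpU-cap) OPEN; K0ᴬ 27238 ∕ K0⁷ 20541 OPEN — NOTHING of them
proved; NODE O 0∕1; COUNT 8∕28 · K 1∕4 UNMOVED; finite 𝕋⁴_{L^K} at fixed ε — NOT continuum ∕ OS ∕ Clay; **the Yang–Mills mass gap is NOT proved by any of this.**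
No `sorry`, no `instance ∕ notation ∕ set_option`; standard axioms.
-/

noncomputable section

open Filter Topology
open scoped BigOperators Matrix.Norms.L2Operator

/-! ## §1  Calculus of the rooted gauge at the unit configuration (generic) -/

namespace Summit.QuantumFields.YangMills.Theorems.K0AxRootGrad

open Literature.MathematicalPhysics.QuantumFieldTheory.Balaban1983to89
open Literature.MathematicalPhysics.QuantumFieldTheory.Balaban1983to89.Node00
open T4RootedResidualGauge (lineHol pathHol rootTransporter rootGauge shiftN steps rootOf lineHol_succ rootTransporter_one)
open GaugeField (gaugeAct)

variable {P : Params} {E : Type*} [NormedAddCommGroup E] [NormedSpace ℝ E]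

/-- The matrices of the straight-line holonomies of a differentiable family of `SU(2)` configurations are differentiable (finite ordered products).
[cite: Balaban1985Averaging, (8) p.19 (bookkeeping)] -/
theorem differentiableAt_coe_lineHol (U : E → GaugeField P 0 (SU 2)) {e₀ : E}
    (hU : ∀ b, DifferentiableAt ℝ (fun e => ((U e b : SU 2) : MatA 2)) e₀) (a : Site P 0) (μ : Fin P.d) :
    ∀ n, DifferentiableAt ℝ (fun e => ((lineHol (U e) a μ n : SU 2) : MatA 2)) e₀
  | 0 => by
      simp only [T4RootedResidualGauge.lineHol_zero, OneMemClass.coe_one]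
      exact differentiableAt_const _
  | n + 1 => by
      have ih := differentiableAt_coe_lineHol U hU a μ n
      show DifferentiableAt ℝ (fun e => ((lineHol (U e) a μ n : SU 2) : MatA 2) * ((U e ⟨shiftN a μ n, μ⟩ : SU 2) : MatA 2)) e₀
      exact ih.mul (hU _)

/-- The matrices of the coordinate-path holonomies of a differentiable family of `SU(2)` configurations are differentiable. [cite: Balaban1985Averaging, (8) p.19 (bookkeeping)] -/
theorem differentiableAt_coe_pathHol (U : E → GaugeField P 0 (SU 2)) {e₀ : E}
    (hU : ∀ b, DifferentiableAt ℝ (fun e => ((U e b : SU 2) : MatA 2)) e₀) :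
    ∀ (l : List (Fin P.d)) (a x : Site P 0), DifferentiableAt ℝ (fun e => ((pathHol (U e) a x l : SU 2) : MatA 2)) e₀
  | [], a, x => by
      simp only [pathHol, OneMemClass.coe_one]
      exact differentiableAt_const _
  | μ :: l, a, x => by
      have ih := differentiableAt_coe_pathHol U hU l (shiftN a μ (steps a x μ)) x
      show DifferentiableAt ℝ (fun e => ((lineHol (U e) a μ (steps a x μ) : SU 2) : MatA 2) *
        ((pathHol (U e) (shiftN a μ (steps a x μ)) x l : SU 2) : MatA 2)) e₀
      exact (differentiableAt_coe_lineHol U hU a μ _).mul ih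

/-- The matrix of the ROOTED TRANSPORTER `g_{U(e)}(x)` is differentiable in `e`. [cite: Balaban1985Variational, (19) p.281 (bookkeeping)] -/
theorem differentiableAt_coe_rootTransporter (k : ℕ) (U : E → GaugeField P 0 (SU 2)) {e₀ : E}
    (hU : ∀ b, DifferentiableAt ℝ (fun e => ((U e b : SU 2) : MatA 2)) e₀) (x : Site P 0) :
    DifferentiableAt ℝ (fun e => ((rootTransporter k (U e) x : SU 2) : MatA 2)) e₀ :=
  differentiableAt_coe_pathHol U hU _ _ _

/-- `Cⁿ` version: the straight-line holonomy matrices of a `Cⁿ` family are `Cⁿ`. [cite: Balaban1985Averaging, (8) p.19 (bookkeeping)] -/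
theorem contDiffAt_coe_lineHol {n : WithTop ℕ∞} (U : E → GaugeField P 0 (SU 2)) {e₀ : E}
    (hU : ∀ b, ContDiffAt ℝ n (fun e => ((U e b : SU 2) : MatA 2)) e₀) (a : Site P 0) (μ : Fin P.d) :
    ∀ m, ContDiffAt ℝ n (fun e => ((lineHol (U e) a μ m : SU 2) : MatA 2)) e₀
  | 0 => by
      simp only [T4RootedResidualGauge.lineHol_zero, OneMemClass.coe_one]
      exact contDiffAt_const
  | m + 1 => by
      have ih := contDiffAt_coe_lineHol U hU a μ m
      show ContDiffAt ℝ n (fun e => ((lineHol (U e) a μ m : SU 2) : MatA 2) * ((U e ⟨shiftN a μ m, μ⟩ : SU 2) : MatA 2)) e₀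
      exact ih.mul (hU _)

/-- `Cⁿ` version: the coordinate-path holonomy matrices of a `Cⁿ` family are `Cⁿ`. [cite: Balaban1985Averaging, (8) p.19 (bookkeeping)] -/
theorem contDiffAt_coe_pathHol {n : WithTop ℕ∞} (U : E → GaugeField P 0 (SU 2)) {e₀ : E}
    (hU : ∀ b, ContDiffAt ℝ n (fun e => ((U e b : SU 2) : MatA 2)) e₀) :
    ∀ (l : List (Fin P.d)) (a x : Site P 0), ContDiffAt ℝ n (fun e => ((pathHol (U e) a x l : SU 2) : MatA 2)) e₀
  | [], a, x => by
      simp only [pathHol, OneMemClass.coe_one]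
      exact contDiffAt_const
  | μ :: l, a, x => by
      have ih := contDiffAt_coe_pathHol U hU l (shiftN a μ (steps a x μ)) x
      show ContDiffAt ℝ n (fun e => ((lineHol (U e) a μ (steps a x μ) : SU 2) : MatA 2) *
        ((pathHol (U e) (shiftN a μ (steps a x μ)) x l : SU 2) : MatA 2)) e₀
      exact (contDiffAt_coe_lineHol U hU a μ _).mul ih

/-- `Cⁿ` version: the bond matrices of the ROOTED GAUGE of a `Cⁿ` family are `Cⁿ` (products and adjoints). [cite: Balaban1985Variational, (19) p.281 (bookkeeping); Balaban1985Variational, Prop. 9 p.309] -/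
theorem contDiffAt_coe_rootGauge {n : WithTop ℕ∞} (k : ℕ) (U : E → GaugeField P 0 (SU 2)) {e₀ : E}
    (hU : ∀ b, ContDiffAt ℝ n (fun e => ((U e b : SU 2) : MatA 2)) e₀) (b : PBond P 0) :
    ContDiffAt ℝ n (fun e => ((rootGauge k (U e) b : SU 2) : MatA 2)) e₀ := by
  have hg : ∀ x, ContDiffAt ℝ n (fun e => ((rootTransporter k (U e) x : SU 2) : MatA 2)) e₀ := fun x =>
    contDiffAt_coe_pathHol U hU _ _ _
  have hst : ContDiffAt ℝ n (fun e => star ((rootTransporter k (U e) b.tgt : SU 2) : MatA 2)) e₀ := by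
    have h := (starL' ℝ : MatA 2 ≃L[ℝ] MatA 2).contDiff.contDiffAt.comp e₀ (hg b.tgt)
    refine h.congr_of_eventuallyEq (Eventually.of_forall fun e => ?_)
    simp only [Function.comp_apply, starL'_apply]
  show ContDiffAt ℝ n (fun e => ((rootTransporter k (U e) b.src : SU 2) : MatA 2) * ((U e b : SU 2) : MatA 2) *
    star ((rootTransporter k (U e) b.tgt : SU 2) : MatA 2)) e₀
  exact ((hg b.src).mul (hU b)).mul hst

/-- ★ **ROOTING IS A GRADIENT AT FIRST ORDER.**  For a family of `SU(2)` configurations `U(e)` with `U(e₀) = 1` and differentiable bond matrices, the rooted gauge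
`(U(e))^{g_{U(e)}}` has, bond by bond, derivative `DU(b) + (Ψ(b.src) − Ψ(b.tgt))` at `e₀`, where `Ψ(x) := D(e ↦ g_{U(e)}(x))(e₀)` takes anti-Hermitian values
(`g ∈ SU(2)` and `g_{U(e₀)} = 1`): the linearised rooting is an UNRESTRICTED pure gradient. [cite: Balaban1985Variational, (19) p.281, (176)–(178) p.306; Balaban1987RG1, (2.3) p.265] -/
theorem hasFDerivAt_coe_rootGauge (k : ℕ) (U : E → GaugeField P 0 (SU 2)) {e₀ : E} (hU0 : U e₀ = 1)
    (hU : ∀ b, DifferentiableAt ℝ (fun e => ((U e b : SU 2) : MatA 2)) e₀) :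
    ∃ Ψ : Site P 0 → E →L[ℝ] MatA 2,
      (∀ x v, star (Ψ x v) = -Ψ x v) ∧
      ∀ b : PBond P 0, HasFDerivAt (fun e => ((rootGauge k (U e) b : SU 2) : MatA 2))
        (fderiv ℝ (fun e => ((U e b : SU 2) : MatA 2)) e₀ + (Ψ b.src - Ψ b.tgt)) e₀ := by
  set g : E → Site P 0 → MatA 2 := fun e x => ((rootTransporter k (U e) x : SU 2) : MatA 2) with hg
  have hgd : ∀ x, DifferentiableAt ℝ (fun e => g e x) e₀ := fun x => differentiableAt_coe_rootTransporter k U hU x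
  have hg0 : ∀ x, g e₀ x = 1 := by
    intro x
    simp only [hg, hU0, rootTransporter_one, OneMemClass.coe_one]
  have hU0b : ∀ b, ((U e₀ b : SU 2) : MatA 2) = 1 := by
    intro b; rw [hU0]; rfl
  have hstar : ∀ x v, star (fderiv ℝ (fun e => g e x) e₀ v) = -fderiv ℝ (fun e => g e x) e₀ v := by
    intro x v
    have h1 : HasFDerivAt (fun e => g e x) (fderiv ℝ (fun e => g e x) e₀) e₀ := (hgd x).hasFDerivAt
    have h2 := h1.star.mul' h1
    have hc : ((fun e => star (g e x)) * fun e => g e x) = fun _ => (1 : MatA 2) := by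
      funext e
      exact Unitary.star_mul_self_of_mem (rootTransporter k (U e) x).2.1
    rw [hc] at h2
    have h3 := (hasFDerivAt_const (1 : MatA 2) e₀).unique h2
    have h4 := congrArg (fun L : E →L[ℝ] MatA 2 => L v) h3
    simp only [hg0, star_one, one_smul, MulOpposite.op_one, zero_apply, add_apply,
      ContinuousLinearMap.comp_apply, ContinuousLinearEquiv.coe_coe, starL'_apply] at h4
    -- h4 : 0 = D v + star (D v)
    exact eq_neg_of_add_eq_zero_right h4.symm
  refine ⟨fun x => fderiv ℝ (fun e => g e x) e₀, hstar, fun b => ?_⟩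
  have h1 : HasFDerivAt (fun e => g e b.src) (fderiv ℝ (fun e => g e b.src) e₀) e₀ := (hgd b.src).hasFDerivAt
  have h2 : HasFDerivAt (fun e => ((U e b : SU 2) : MatA 2)) (fderiv ℝ (fun e => ((U e b : SU 2) : MatA 2)) e₀) e₀ := (hU b).hasFDerivAt
  have h3 := (hgd b.tgt).hasFDerivAt.star
  have h := (h1.mul' h2).mul' h3
  have hfun : (fun e => ((rootGauge k (U e) b : SU 2) : MatA 2)) =
      ((fun e => g e b.src) * fun e => ((U e b : SU 2) : MatA 2)) * fun e => star (g e b.tgt) := by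
    funext e; rfl
  rw [hfun]
  refine h.congr_fderiv ?_
  ext1 v
  simp only [hg0, hU0b, star_one, mul_one, one_smul, MulOpposite.op_one, Pi.mul_apply, add_apply,
    sub_apply, ContinuousLinearMap.comp_apply, ContinuousLinearEquiv.coe_coe, starL'_apply, hstar]
  abel

/-- The entry array of a bond-indexed matrix family, as a continuous linear map (finite dimensions). [folklore] -/
theorem exists_entriesCLM (ι : Type*) [Fintype ι] :
    ∃ Φ : (ι → MatA 2) →L[ℝ] (ι → Fin 2 → Fin 2 → ℂ), ∀ W b i i', Φ W b i i' = W b i i' := by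
  have h := fun i i' : Fin 2 => PortU8.exists_entryCLM i i'
  choose En hEn using h
  refine ⟨ContinuousLinearMap.pi fun b => ContinuousLinearMap.pi fun i => ContinuousLinearMap.pi fun i' =>
    (En i i').comp (ContinuousLinearMap.proj b), fun W b i i' => ?_⟩
  simp [hEn]

/-- The ENTRYWISE derivative (the currency of ✓`recordD`) from a bondwise matrix derivative. [folklore] -/
theorem fderiv_entries_apply {ι : Type*} [Fintype ι] (M : E → ι → MatA 2) {M' : E →L[ℝ] (ι → MatA 2)} {e₀ : E}
    (hM : HasFDerivAt M M' e₀) (v : E) (b : ι) (i i' : Fin 2) :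
    fderiv ℝ (fun e => fun (b : ι) (i i' : Fin 2) => (M e b : MatA 2) i i') e₀ v b i i' = M' v b i i' := by
  obtain ⟨Φ, hΦ⟩ := exists_entriesCLM ι
  have h2 : HasFDerivAt (fun e => fun (b : ι) (i i' : Fin 2) => (M e b : MatA 2) i i') (Φ.comp M') e₀ := by
    refine (Φ.hasFDerivAt.comp e₀ hM).congr_of_eventuallyEq (Eventually.of_forall fun e => ?_)
    funext b i i'
    simp only [Function.comp_apply, hΦ]
  rw [h2.fderiv]
  simp only [ContinuousLinearMap.comp_apply, hΦ]

/-- `Cⁿ` ENTRY arrays from `Cⁿ` bond matrices. [folklore] -/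
theorem contDiffAt_entries {ι : Type*} [Fintype ι] {n : WithTop ℕ∞} (M : E → ι → MatA 2) {e₀ : E}
    (hM : ∀ b, ContDiffAt ℝ n (fun e => M e b) e₀) :
    ContDiffAt ℝ n (fun e => fun (b : ι) (i i' : Fin 2) => (M e b : MatA 2) i i') e₀ := by
  obtain ⟨Φ, hΦ⟩ := exists_entriesCLM ι
  have hpi : ContDiffAt ℝ n (fun e => fun b => M e b) e₀ := contDiffAt_pi.2 hM
  have h := Φ.contDiff.contDiffAt.comp e₀ hpi
  refine h.congr_of_eventuallyEq (Eventually.of_forall fun e => ?_)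
  funext b i i'
  simp only [Function.comp_apply, hΦ]

end Summit.QuantumFields.YangMills.Theorems.K0AxRootGrad

end
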